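import Mathlib
import Summits.Ventures.PercRepro2.HCov
import Summits.Ventures.PercRepro2.EdgeCubic
import Summits.Ventures.PercRepro2.EdgeCubicAll
import Summits.Ventures.PercRepro2.CPolarA3
import Summits.Ventures.PercRepro2.CPolarA3Marks
import Summits.Ventures.PercRepro2.PendantA3Pins
import Summits.Ventures.PercRepro2.PendantClusterPins
import Summits.Ventures.PercRepro2.PendantClusterMasses
import Summits.Ventures.PercRepro2.CPolarA3Exists
import Summits.Ventures.PercRepro2.ClusterRootBern
import Summits.Ventures.PercRepro2.ReachRootEdge
import Summits.Ventures.PercRepro2.CPolarSub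
import Summits.Ventures.PercRepro2.CPolarSubPlus
import Summits.Ventures.PercRepro2.HCovPlusDiag
import Summits.Ventures.PercRepro2.CPolarSubNP
import Summits.Ventures.PercRepro2.InternalEdge
import Summits.Ventures.PercRepro2.QuarticPendant
import Summits.Ventures.PercRepro2.HCovPlusQuartic

import Summits.Ventures.PercRepro2.QuarticRoadBase
import Summits.Ventures.PercRepro2.QuarticRoadPendantRoot
/-!
# THE ROAD ON THE QUARTIC AS ONE INDUCTION: (HCOV) ∧ (HCOV⁺) on every finite graph from ONE
per-edge hypothesis on the domain of `CPolarA3SubB2_all` — no global `HCovPlus_all`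
(blind cell PercRepro2, p5 g17; `proofs/P5-OEDGE.md` §23)

The induction carries (HCOV) AND (HCOV⁺) together, on the number of fractional edges, for all
markings at once. What is free (`QuarticRoadBase`, `QuarticRoadPendantRoot`): a mark in the reach
of `a₃`, a null `Q`, a reach with no fractional boundary edge, an internal fractional reach-edge,
and — the point of the quartic road — the PENDANT edge `f = {z, u}`: with `P(PD_u) > 0` the
identified instance `(o, a₁, a₂, u, b)` does not see the pin of `f` (`hcovPlusVal_blob_eq`), so
its (HCOV⁺) comes from the induction hypothesis at `p[f↦0]` (one fractional edge fewer) or from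
the diagonal theorems, and `QuarticPendant.hcovPlus_of_pendant` /
`CPolarSubPlus.sub_of_pendant_of_hcovPlus` give both components at `p`; with `P(PD_u) = 0` the
edge leads into a root's reach and `HCovPlus_of_pendant_rootReach` closes the quartic (the cubic
by `ReachRoot.bern_nonneg_of_isReachRootEdge`). Every other instance — mark-free, non-null, no
internal edge, no pendant edge, i.e. EXACTLY the domain of `InternalEdge.CPolarA3SubB2_all` — must
offer ONE fractional boundary edge that is `GoodEdgeSub` for the cubic AND has `0 ≤ H1, H2, H3`
for the quartic (**`JointGood`**; the pins supply (HCOV) ∧ (HCOV⁺) by induction):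
**`HCov_all_and_HCovPlus_all_of_jointGood_all : JointGood_all R → HCov_all R ∧ HCovPlus_all R`**.
So the global hypothesis (H1) of the cubic road is traded for the quartic's three coefficients at
the chosen edge (census-nonnegative on 1,876,715 lines, kit j277190; open at the root edges, the
`o`-edges and class (α)).
-/

namespace Summit.Ventures.PercRepro2

open UnionCluster CovForm CovForm.CPolarA3 CovForm.EdgeLine PendantA3 PendantCluster CPolarA3Exists
  ClusterRoot ReachRoot CPolarSub CPolarSubPlus HCovPlusDiag CPolarSubNP InternalEdge
  QuarticPendant HCovPlusQuartic QuarticRoadBase QuarticRoadPendantRoot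

namespace QuarticRoad

/-! ## The joint induction -/
section Induction

variable {V E : Type} [Fintype V] [DecidableEq V] [Fintype E] [DecidableEq E]
  {R : Type*} [Field R] [LinearOrder R] [IsStrictOrderedRing R]

/-- **A jointly good edge**: `GoodEdgeSub` for the cubic and `0 ≤ H1, H2, H3` for the quartic. -/
def JointGood (p : E → R) (ends : E → Sym2 V) (o a₁ a₂ a₃ b : V) (e : E) : Prop :=
  GoodEdgeSub p ends o a₁ a₂ a₃ b e ∧ 0 ≤ H1 p ends o a₁ a₂ a₃ b e ∧
    0 ≤ H2 p ends o a₁ a₂ a₃ b e ∧ 0 ≤ H3 p ends o a₁ a₂ a₃ b e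

omit [Fintype V] [DecidableEq V] [LinearOrder R] [IsStrictOrderedRing R] in
/-- `PD(a₁, a₂, a₁)` is empty: a root is in `U`. -/
lemma prob_PD_root_self (p : E → R) (ends : E → Sym2 V) (a₁ a₂ : V) :
    prob p (PDEvent ends a₁ a₂ a₁) = 0 := by
  have h : PDEvent ends a₁ a₂ a₁ = ∅ := by
    ext ω
    simp only [PDEvent, Dtilde, Set.mem_inter_iff, Set.mem_compl_iff, mem_inU,
      Set.mem_empty_iff_false, iff_false, not_and, not_not]
    intro _
    exact Or.inl (conn_refl ends ω a₁)
  rw [h, prob_empty]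

omit [Fintype V] [DecidableEq V] [LinearOrder R] [IsStrictOrderedRing R] in
/-- `PD(a₁, a₂, a₂)` is empty. -/
lemma prob_PD_root_self' (p : E → R) (ends : E → Sym2 V) (a₁ a₂ : V) :
    prob p (PDEvent ends a₁ a₂ a₂) = 0 := by
  have h : PDEvent ends a₁ a₂ a₂ = ∅ := by
    ext ω
    simp only [PDEvent, Dtilde, Set.mem_inter_iff, Set.mem_compl_iff, mem_inU,
      Set.mem_empty_iff_false, iff_false, not_and, not_not]
    intro _
    exact Or.inr (conn_refl ends ω a₂)
  rw [h, prob_empty]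

/-- **The joint induction**: (HCOV) ∧ (HCOV⁺) at every instance from a jointly good boundary edge at
every mark-free non-null instance with no internal edge and no pendant edge. -/
theorem HCov_and_HCovPlus_of_jointGood (ends : E → Sym2 V)
    (hB : ∀ q : E → R, IsProbVec q → ∀ o a₁ a₂ a₃ b : V, a₁ ≠ a₂ → a₁ ≠ a₃ → a₂ ≠ a₃ → o ≠ a₁ →
      o ≠ a₂ → o ≠ a₃ → o ≠ b → b ≠ a₁ → b ≠ a₂ → b ≠ a₃ → MarkFree q ends o a₁ a₂ a₃ b →
      prob q (avoidAll ends a₂ {a₁}) ≠ 0 → (∃ e ∈ fracEdges q, TouchesReach q ends a₃ e) →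
      (¬ ∃ e ∈ fracEdges q, IsInternalEdge q ends a₃ e) →
      (¬ ∃ f, IsPendantEdge q ends a₃ f) →
      ∃ e ∈ fracEdges q, TouchesReach q ends a₃ e ∧ JointGood q ends o a₁ a₂ a₃ b e) :
    ∀ n : ℕ, ∀ p : E → R, IsProbVec p → (fracEdges p).card = n →
      ∀ o a₁ a₂ a₃ b : V, a₁ ≠ a₂ → a₁ ≠ a₃ → a₂ ≠ a₃ → o ≠ a₁ → o ≠ a₂ → o ≠ a₃ → o ≠ b →
        b ≠ a₁ → b ≠ a₂ → b ≠ a₃ →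
        HCov p ends o a₁ a₂ a₃ b ∧ HCovPlus p ends o a₁ a₂ a₃ b := by
  intro n
  induction n using Nat.strong_induction_on with
  | _ n ih =>
  intro p hp hn o a₁ a₂ a₃ b h1 h2 h3 h4 h5 h6 h7 h8 h9 h10
  by_cases hm : a₁ ∈ pinnedReach p ends a₃ ∨ a₂ ∈ pinnedReach p ends a₃ ∨
      o ∈ pinnedReach p ends a₃ ∨ b ∈ pinnedReach p ends a₃
  · exact ⟨HCov_of_mark_mem_pinnedReach hp hm, HCovPlus_of_mark_mem_pinnedReach hp hm⟩
  have hfree : MarkFree p ends o a₁ a₂ a₃ b := by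
    simp only [not_or] at hm
    exact ⟨hm.1, hm.2.1, hm.2.2.1, hm.2.2.2⟩
  by_cases hQ : prob p (avoidAll ends a₂ {a₁}) = 0
  · exact ⟨HCov_of_Q_eq_zero hp hQ, HCovPlus_of_Q_eq_zero hp hQ⟩
  have hQpos : 0 < prob p (avoidAll ends a₂ {a₁}) :=
    lt_of_le_of_ne (prob_nonneg hp _) (Ne.symm hQ)
  -- the induction hypothesis at a pin of a fractional edge, for any marking
  have ihpin : ∀ e ∈ fracEdges p, ∀ c : R, c = 0 ∨ c = 1 →
      ∀ o' a₁' a₂' a₃' b' : V, a₁' ≠ a₂' → a₁' ≠ a₃' → a₂' ≠ a₃' → o' ≠ a₁' → o' ≠ a₂' → o' ≠ a₃' →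
        o' ≠ b' → b' ≠ a₁' → b' ≠ a₂' → b' ≠ a₃' →
        HCov (Function.update p e c) ends o' a₁' a₂' a₃' b' ∧
          HCovPlus (Function.update p e c) ends o' a₁' a₂' a₃' b' := by
    intro e he c hc o' a₁' a₂' a₃' b' g1 g2 g3 g4 g5 g6 g7 g8 g9 g10
    have hlt : ((fracEdges p).erase e).card < n := by
      rw [← hn]; exact Finset.card_erase_lt_of_mem he
    have hpc : IsProbVec (Function.update p e c) := by
      rcases hc with rfl | rfl
      · exact hp.update e le_rfl zero_le_one
      · exact hp.update e zero_le_one le_rfl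
    exact ih _ hlt (Function.update p e c) hpc (by rw [fracEdges_update p e c hc]) o' a₁' a₂' a₃' b'
      g1 g2 g3 g4 g5 g6 g7 g8 g9 g10
  by_cases hint : ∃ e ∈ fracEdges p, IsInternalEdge p ends a₃ e
  · obtain ⟨e, he, u, z, hends, hu, hz⟩ := hint
    have hfe : p e ≠ 0 ∧ p e ≠ 1 := by simpa [fracEdges] using he
    obtain ⟨hc, hcp⟩ := ihpin e he 0 (Or.inl rfl) o a₁ a₂ a₃ b h1 h2 h3 h4 h5 h6 h7 h8 h9 h10
    exact ⟨HCov_of_internal hu hz hends hfe.2 o a₁ a₂ b hc,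
      HCovPlus_of_internal hu hz hends hfe.2 o a₁ a₂ b hcp⟩
  by_cases h : ∃ e ∈ fracEdges p, TouchesReach p ends a₃ e
  · by_cases hpend : ∃ f, IsPendantEdge p ends a₃ f
    · -- the pendant face
      obtain ⟨f, hK, z, u, hf, hz, hu⟩ := hpend
      obtain ⟨e, he, ht⟩ := h
      have hef : e = f := hK e he ht
      subst hef
      have hfe : p e ≠ 0 ∧ p e ≠ 1 := by simpa [fracEdges] using he
      obtain ⟨hc0, hcp0⟩ := ihpin e he 0 (Or.inl rfl) o a₁ a₂ a₃ b h1 h2 h3 h4 h5 h6 h7 h8 h9 h10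
      obtain ⟨hc1, -⟩ := ihpin e he 1 (Or.inr rfl) o a₁ a₂ a₃ b h1 h2 h3 h4 h5 h6 h7 h8 h9 h10
      by_cases hD : prob p (PDEvent ends a₁ a₂ u) = 0
      · -- `u` in a root's reach: a reach-root edge for the cubic, `HCovPlus_of_pendant_rootReach` for the quartic
        have hur := mem_reach_of_prob_PD_eq_zero hp hQ hD
        obtain ⟨hB1, hB2⟩ := bern_nonneg_of_isReachRootEdge p hp ends o a₁ a₂ a₃ b e
          ⟨z, hz, u, hur, Or.inr hf⟩ hfe.2 hc0
        exact ⟨HCov_of_update_zero_of_bern p hp ends o a₁ a₂ a₃ b e hc0 hc1 hB1 hB2,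
          HCovPlus_of_pendant_rootReach hK hf hz hu hfe.2 hp hfree.1 hfree.2.1 hfree.2.2.1
            hfree.2.2.2 hur hc0 hcp0⟩
      have hDpos : 0 < prob p (PDEvent ends a₁ a₂ u) :=
        lt_of_le_of_ne (prob_nonneg hp _) (Ne.symm hD)
      -- (HCOV⁺) at the identified instance `(o, a₁, a₂, u, b)`
      have hplus : HCovPlus p ends o a₁ a₂ u b := by
        by_cases huo : u = o
        · subst huo; exact hcovPlus_diag_o p hp a₁ a₂ u b
        by_cases hub : u = b
        · subst hub; exact hcovPlus_diag_b p hp o a₁ a₂ u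
        by_cases hu1 : u = a₁
        · subst hu1; rw [prob_PD_root_self] at hDpos; exact absurd hDpos (lt_irrefl 0)
        by_cases hu2 : u = a₂
        · subst hu2; rw [prob_PD_root_self'] at hDpos; exact absurd hDpos (lt_irrefl 0)
        obtain ⟨-, hcpu⟩ := ihpin e he 0 (Or.inl rfl) o a₁ a₂ u b h1 (Ne.symm hu1) (Ne.symm hu2)
          h4 h5 (Ne.symm huo) h7 h8 h9 (Ne.symm hub)
        rw [HCovPlus_iff] at hcpu ⊢
        rw [← hcovPlusVal_blob_eq hK hf hz hu hfe.2 hfree.1 hfree.2.1 hfree.2.2.1 hfree.2.2.2]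
        exact hcpu
      refine ⟨?_, hcovPlus_of_pendant hp hK hf hz hu hfe.2 hfree.1 hfree.2.1 hfree.2.2.1 hfree.2.2.2
        hDpos hplus⟩
      obtain ⟨hQ0, hD0, -⟩ := pins_zero_cluster p hK hf hz hu hfe.2 hfree.1 hfree.2.1 hfree.2.2.1
        hfree.2.2.2
      have hpos : PinsPos p ends a₁ a₂ a₃ e :=
        ⟨by rw [hQ0]; exact hQpos, by rw [hD0]; exact hQpos⟩
      obtain ⟨hs1, hs2⟩ := sub_of_pendant_of_hcovPlus hK hf hz hu hfe.2 hfree.1 hfree.2.1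
        hfree.2.2.1 hfree.2.2.2 hDpos hQpos hc1 hplus
      exact HCov_of_update_zero_of_sub p hp ends o a₁ a₂ a₃ b e hpos hc0 hc1 hs1 hs2
    · -- the hypothesis: a jointly good boundary edge
      obtain ⟨e, he, -, hgood, hH1, hH2, hH3⟩ :=
        hB p hp o a₁ a₂ a₃ b h1 h2 h3 h4 h5 h6 h7 h8 h9 h10 hfree hQ h hint hpend
      have hfe : p e ≠ 0 ∧ p e ≠ 1 := by simpa [fracEdges] using he
      obtain ⟨hc0, hcp0⟩ := ihpin e he 0 (Or.inl rfl) o a₁ a₂ a₃ b h1 h2 h3 h4 h5 h6 h7 h8 h9 h10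
      obtain ⟨hc1, hcp1⟩ := ihpin e he 1 (Or.inr rfl) o a₁ a₂ a₃ b h1 h2 h3 h4 h5 h6 h7 h8 h9 h10
      refine ⟨?_, HCovPlus_of_update_zero_of_bern p hp ends o a₁ a₂ a₃ b e hcp0 hcp1 hH1 hH2 hH3⟩
      rcases hgood with (hr | hpa | ⟨hB1, hB2⟩) | ⟨hpos, hs1, hs2⟩
      · obtain ⟨hB1, hB2⟩ := bern_nonneg_of_isReachRootEdge p hp ends o a₁ a₂ a₃ b e hr hfe.2 hc0
        exact HCov_of_update_zero_of_bern p hp ends o a₁ a₂ a₃ b e hc0 hc1 hB1 hB2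
      · obtain ⟨hK, z, u, hends, hz, hu, hD, hcov⟩ := hpa
        exact HCov_cluster_of_cov_nonneg p hp hK hends hz hu hfe.2 hfree.1 hfree.2.1 hfree.2.2.1
          hfree.2.2.2 hD hc0 hc1 hcov
      · exact HCov_of_update_zero_of_bern p hp ends o a₁ a₂ a₃ b e hc0 hc1 hB1 hB2
      · exact HCov_of_update_zero_of_sub p hp ends o a₁ a₂ a₃ b e hpos hc0 hc1 hs1 hs2
  · simp only [not_exists, not_and] at h
    exact ⟨HCov_of_reach_pinned p hp ends o a₁ a₂ a₃ b h, HCovPlus_of_reach_pinned hp o a₁ a₂ a₃ b h⟩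

end Induction

section Closure

variable (R : Type*) [Field R] [LinearOrder R] [IsStrictOrderedRing R]

/-- **The per-edge hypothesis of the road on the quartic** (the domain of `CPolarA3SubB2_all`):
every mark-free non-null instance with a fractional `a₃`-edge, no internal fractional reach-edge and
no pendant edge has a fractional boundary edge that is `GoodEdgeSub` (cubic) with `0 ≤ H1, H2, H3`
(quartic). -/
def JointGood_all : Prop :=
  ∀ (V E : Type) [Fintype V] [DecidableEq V] [Fintype E] [DecidableEq E]
    (ends : E → Sym2 V) (p : E → R), IsProbVec p →
    ∀ o a₁ a₂ a₃ b : V, a₁ ≠ a₂ → a₁ ≠ a₃ → a₂ ≠ a₃ → o ≠ a₁ → o ≠ a₂ → o ≠ a₃ → o ≠ b →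
      b ≠ a₁ → b ≠ a₂ → b ≠ a₃ → MarkFree p ends o a₁ a₂ a₃ b →
      prob p (avoidAll ends a₂ {a₁}) ≠ 0 → (∃ e ∈ fracEdges p, TouchesReach p ends a₃ e) →
      (¬ ∃ e ∈ fracEdges p, IsInternalEdge p ends a₃ e) →
      (¬ ∃ f, IsPendantEdge p ends a₃ f) →
      ∃ e ∈ fracEdges p, TouchesReach p ends a₃ e ∧ JointGood p ends o a₁ a₂ a₃ b e

/-- **The crux AND (HCOV⁺) on every finite graph from the per-edge hypothesis of the quartic road**
(no global `HCovPlus_all`). -/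
theorem HCov_all_and_HCovPlus_all_of_jointGood_all (h : JointGood_all R) :
    HCov_all R ∧ HCovPlus_all R := by
  have key : ∀ (V E : Type) [Fintype V] [DecidableEq V] [Fintype E] [DecidableEq E]
      (ends : E → Sym2 V) (p : E → R), IsProbVec p →
      ∀ o a₁ a₂ a₃ b : V, a₁ ≠ a₂ → a₁ ≠ a₃ → a₂ ≠ a₃ → o ≠ a₁ → o ≠ a₂ → o ≠ a₃ → o ≠ b →
        b ≠ a₁ → b ≠ a₂ → b ≠ a₃ → HCov p ends o a₁ a₂ a₃ b ∧ HCovPlus p ends o a₁ a₂ a₃ b := by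
    intro V E _ _ _ _ ends p hp o a₁ a₂ a₃ b h1 h2 h3 h4 h5 h6 h7 h8 h9 h10
    exact HCov_and_HCovPlus_of_jointGood ends
      (fun q hq o' a₁' a₂' a₃' b' g1 g2 g3 g4 g5 g6 g7 g8 g9 g10 hfree hQ hex hint hnp =>
        h V E ends q hq o' a₁' a₂' a₃' b' g1 g2 g3 g4 g5 g6 g7 g8 g9 g10 hfree hQ hex hint hnp)
      _ p hp rfl o a₁ a₂ a₃ b h1 h2 h3 h4 h5 h6 h7 h8 h9 h10
  exact ⟨fun V E _ _ _ _ ends p hp o a₁ a₂ a₃ b h1 h2 h3 h4 h5 h6 h7 h8 h9 h10 =>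
      (key V E ends p hp o a₁ a₂ a₃ b h1 h2 h3 h4 h5 h6 h7 h8 h9 h10).1,
    fun V E _ _ _ _ ends p hp o a₁ a₂ a₃ b h1 h2 h3 h4 h5 h6 h7 h8 h9 h10 =>
      (key V E ends p hp o a₁ a₂ a₃ b h1 h2 h3 h4 h5 h6 h7 h8 h9 h10).2⟩

omit [IsStrictOrderedRing R] in
/-- `JointGood_all` strengthens (H2) `CPolarA3SubB2_all` on the same domain (drop the quartic part). -/
theorem cpolarA3SubB2_all_of_jointGood_all (h : JointGood_all R) : CPolarA3SubB2_all R :=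
  fun V E _ _ _ _ ends p hp o a₁ a₂ a₃ b h1 h2 h3 h4 h5 h6 h7 h8 h9 h10 hfree hQ hex hint hnp =>
    let ⟨e, he, ht, hg⟩ := h V E ends p hp o a₁ a₂ a₃ b h1 h2 h3 h4 h5 h6 h7 h8 h9 h10 hfree hQ hex
      hint hnp
    ⟨e, he, ht, hg.1⟩

end Closure

end QuarticRoad

end Summit.Ventures.PercRepro2
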